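import Summits.QuantumFields.BalabanUV.Beta.D1BFx.PackedColumnBlockTotalMass
import Summits.QuantumFields.BalabanUV.Beta.D1BFx.PackedColumnTableMass

/-!
# `BalabanUV.Beta.D1BFx.PackedColumnBlockPairTotalMass` — road «BF-x» for binder row D1, slot (K), the [M] TABLE rows in the shape ruled R-D1-g43-1 (M-b):
# **THE PACKED BI-VERTEX ROW FROM BLOCK-PAIR-TOTAL LETTERS — A PAIR PACK WHOSE PLAIN BLOCK MASSES HAVE BLOCK-PAIR TOTALS
# `Σ_{b,b′ ∈ box 4 n} M(n•y₁ + b, n•y₂ + b′) ≤ n⁸·m̄B·e^{−θ|y₂ − y₁|₁}` GIVES, THROUGH ANY PACKED KERNEL WITH A COLUMN ENVELOPE `C_H·e^{−ρ|u − n•y|₁}`, A BI-VERTEX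
# `vertex2OfK K n S₂ μ y ν y′` WHOSE EVERY BLOCK HAS PLAIN MASS `≤ 16·C_H²·e^{2ρ·4·n}·n⁸·m̄B·Zl 4 (ρn∕2)·Zl 4 (θ∕2)·e^{−min (ρn∕2) (θ∕2)|y′ − y|₁}`; AT THE ROAD's
# `colH (G₀^{bm} r) n` (`C_H = (n⁴)⁻¹·C_{G₀}`, `ρ = κ′∕(4n)`): `≤ 16·C_{G₀}²·e^{2κ′}·Zl 4 (κ′∕8)·Zl 4 (θ∕2)·m̄B j i·e^{−min (κ′∕8) (θ∕2)|y′ − y|₁}` — POWER `n⁰`**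
# (§1–§3 GENERIC ∕ any packed `K` — pin-agnostic; §4 the road's own weights, any in-block root; UNCONDITIONAL)

HONEST DEPENDENCY (cell records, verbatim): «continuum YM on T⁴ ⇐ BetaPertH ∧ nine spine estimates (0/9 proved); BetaPertH ⇐ (D1) ∧ (D4) ∧
CAP+tail; G-an2-4 gates asym, D1 and NE2/3/4.»  HONEST FRAMING (cell contract, verbatim): «discharging `BetaPertH` makes Bałaban's UV stability
UNCONDITIONAL — a real constructive-QFT result; it is NOT the continuum limit and NOT the Clay problem.»  THIS MODULE DISCHARGES NOTHING of the
wall: [folklore] `ℓ¹` bookkeeping BY NAME over this lineage's block-total tools (`PackedColumnBlockTotalMass.exp_block_offset_le`), «G0-COL-ENV»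
(`PackedColumnEnvelope.abs_colH_G₀_road_le`), d1-leaf-04's generic mass lemmas (`GhostWordJetMass.mass_wsum_le ∕ mass_finset_sum_le`,
`RestNestedMass.tsum_tsum_exp_triangle_le`, `RestTableBlockMass.blk_vertex2OfK`), the block regrouping `KKTFluctuationEnergy.tsum_blocks ∕ summable_blocks`
and an2's `ExpKernelCalculus` lattice constants.  Every mass letter of the pair pack is a DISPLAYED hypothesis on an ARBITRARY family; nothing about
Bałaban's (or an1's ∕ an3's) tables is asserted.  No definition, no `def … : Prop`, nothing cited, 0 sorry.  NO (1.22) unit row is proved here.  0 root-level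
binders of row D1 discharged (hW ∕ hR-sockets ∕ hSX-socket ∕ D1Tel ∕ D1Rep = 0); (J1)∕[W] OPEN; (K) NOT closed; NOT D1, NOT `BetaPertH`, NOT continuum, NOT Clay.

ABSOLUTE RULE (cell charter, verbatim): «No internally-minted statement may enter as a cited fact. Every hypothesis is either kernel-proved in
this package or a verbatim quotation of a PUBLISHED theorem with page reference. The manuscript(s) under audit are NOT citable for their own
disputed steps — they are the thing under adjudication; programme-internal (2001/route/tribunal) claims are never citable.»

WHY (row OWNER an2 g43 RULING R-D1-g43-1 (M-b)(iii), journal: «fm∕mf rows (and `S₂⁰`'s `vh₂S` rows) in PACKED-VERTEX form per coarse bond»; d1-leaf-01 g27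
INTENT-3, journal: the Wilson pair sector of `S₂⁰ = T2RecOf … 0` meets the END's per-slot-pair `hBm` with a k-free table, «the border pair sector `cB • vh₂S` gets
NO per-slot-pair k-free row — by (M-b) its mass rows go PACKED»; road OWNER d1-p2 g22 F-g22-1 §4: [M] packed at the road's weights under (P-hyb)).  The END's
(L2-M) letter (`PackedRoadRowsMass.table_letters_mass`: `hBs hBm`, plain per-slot-pair block masses `≤ mB j i·e^{−(δ₀∕n)|u′ − u|₁}`) feeds the packed table rows
through the per-slot-pair lemma `RestTableBlockMass.mass_blk_vertex2OfK_le` (at «G0-COL-ENV»: `PackedColumnTableMass.mass_blk_vertex2OfK_G₀_le_blockRate`).  For a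
covariance-type pair table whose per-slot-pair sup is not k-free the same conversion must run on BLOCK-PAIR TOTALS with the pair decay read in BLOCK units —
this file: both packed weights are flat across a block up to `e^{ρ·4·n}` (= `e^{κ′}` at the road's rate `κ′∕(4n)`), so after regrouping both `u`-sums by
coarse blocks only the totals `Σ_{b,b′} M(n•y₁ + b, n•y₂ + b′)` are seen, and their coarse decay `e^{−θ|y₂ − y₁|₁}` convolves with the two coarse envelopes
`e^{−(ρn)|y₁ − y|₁}`, `e^{−(ρn)|y₂ − y′|₁}` into `Zl 4 (ρn∕2)·Zl 4 (θ∕2)·e^{−min (ρn∕2) (θ∕2)|y′ − y|₁}`; `(n⁴)⁻²` of the two envelopes against `n⁸` of the block-pair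
total = POWER `n⁰`.  The letter SHAPE (`n⁸·m̄B j i·e^{−θ|y₂ − y₁|₁}`, `θ` in block units, uniform under simultaneous coarse translation) is this lineage's
PROPOSAL for the table author's count; §1–§3 do not depend on the pin (F-g22-1 Q-g22-1), §4 is the road's own weight family at any in-block root.
`n = m + 1`, `κ′ = kappa163 4 ∕ 4`, `C_{G₀} = (MG163 4·periodConst (kappa163 4) 3)·(1 + 8(1 + e^{κ′}))·e^{κ′}`.

CONTENT (all [folklore]).
* §1 GENERIC scalar (any `D`, `[NeZero n]`): **`tsum_mul_tsum_le_of_blockPairTotal`**.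
* §2 GENERIC kernel (any `D`, fibre `F`, finite colour type `ι`): **`mass_nested_wsum_le_of_blockPairTotal`** — the nested superposition
  `Σ_i wsum (w₁ i) (u ↦ Σ_{i′} wsum (w₂ i′) (P i u i′))` has summable plain mass `≤ |ι|²·C₁·C₂·e^{ρDn}·e^{ρDn}·T·Zl D (ρn∕2)·Zl D (θ∕2)·e^{−min (ρn∕2) (θ∕2)|y′ − y|₁}`
  from per-slot-pair summability and block-pair totals `≤ T·e^{−θ|y₂ − y₁|₁}` (d1-leaf-04's `mass_wsum_le ∕ mass_finset_sum_le` with the ACTUAL masses as letters, then §1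
  colour pair by colour pair) — the block-pair-total companion of `RestNestedMass.mass_nested_wsum_le`.
* §3 `d = 3`, ANY packed `K` with a column envelope: **`mass_blk_vertex2OfK_le_of_blockPairTotal`** — the block-pair-total companion of
  `RestTableBlockMass.mass_blk_vertex2OfK_le` (`blk_vertex2OfK` BY NAME).
* §4 the road's gauged weights `colH (G₀^{bm} r) n`, any in-block root: **`mass_blk_vertex2OfK_G₀_le_of_blockPairTotal`** —
  `≤ 16·C_{G₀}²·e^{2κ′}·Zl 4 (κ′∕8)·Zl 4 (θ∕2)·m̄B j i·e^{−min (κ′∕8) (θ∕2)|y′ − y|₁}` from block-pair totals `≤ n⁸·m̄B j i·e^{−θ|y₂ − y₁|₁}`.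
NOT HERE (honest): the block-pair-total letters themselves (the table author's count); the `GcombSh` twin of §4 (on demand — §3 at `CombColumnEnvelope.abs_colH_GcombSh_road_le`);
the per-slot-pair currency (IN TREE: `PackedColumnTableMass`, `CombColumnTableMass` staged); any (1.22) row; PART 23 (the road OWNER's, pin pending).
Unit `b2b-balaban-gan24-formalise-leaf-05` (gen 57), G-an2-4 swarm leaf prover 05, road «BF-x» supplier; INTENT-2 «TABLE-MASS-BLOCKTOTAL» (journal).
-/

noncomputable section

open Finset
open scoped BigOperators
open Literature.MathematicalPhysics.QuantumFieldTheory.Balaban1983to89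
open Literature.MathematicalPhysics.QuantumFieldTheory.Balaban1983to89.Beta
open B12Sec2to5 (l1 l1_nonneg)
open B5Hk163Strip (kappa163 kappa163_pos)
open B5Hk163Decay (MG163)
open B4TorusKernel (periodConst)
open ExpKernelCalculus (Site MKer Zl Zl_pos Zl_nonneg tsum_exp_shift' summable_exp_shift' l1_natSmul l1_sub_triangle l1_sub_symm)
open AffineAveraging (box toSite)
open AveragingContours (off off_mem_box blk_add_off)
open KKTFluctuationEnergy (tsum_blocks summable_blocks)
open OneStepResolventKernel (Fib wsum)
open OneStepKernelFamily (colH KInvStep vertexOfK)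
open SecondOrderResponse (vertex2OfK)
open Summit.QuantumFields.BalabanUV.Beta.AxialDressingRooted (coDressKBmAt)
open Summit.QuantumFields.BalabanUV.Beta.D1BFx.PackedKernelSplit (blk)
open Summit.QuantumFields.BalabanUV.Beta.D1BFx.GhostWordJetMass (mass_wsum_le mass_finset_sum_le)
open Summit.QuantumFields.BalabanUV.Beta.D1BFx.RestNestedMass (tsum_tsum_exp_triangle_le)
open Summit.QuantumFields.BalabanUV.Beta.D1BFx.RestTableBlockMass (blk_vertex2OfK l1_smul_sub)
open Summit.QuantumFields.BalabanUV.Beta.D1BFx.PackedColumnEnvelope (abs_colH_G₀_road_le colH_G₀_road_weight_nonneg)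
open Summit.QuantumFields.BalabanUV.Beta.D1BFx.PackedColumnBlockTotalMass (exp_block_offset_le)

namespace Summit.QuantumFields.BalabanUV.Beta.D1BFx.PackedColumnBlockPairTotalMass

/-! ## §1 Generic: two `ℓ¹`-exponential envelopes against a pair function with decaying block-pair totals -/

section Generic

/-- [folklore] **TWO ENVELOPED WEIGHTS AGAINST A PAIR FUNCTION WITH DECAYING BLOCK-PAIR TOTALS** (GENERIC; any dimension `D`, block side `n ≥ 1`): if
`|w₁ u| ≤ W₁·e^{−ρ|u − n•y|₁}`, `|w₂ u′| ≤ W₂·e^{−ρ|u′ − n•y′|₁}` (`0 < ρ`, `0 ≤ W₁, W₂`) and `m ≥ 0` has BLOCK-PAIR totals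
`Σ_{b, b′ ∈ box D n} m (n•y₁ + b) (n•y₂ + b′) ≤ T·e^{−θ|y₂ − y₁|₁}` (`0 < θ`, coarse decay in BLOCK units) for every pair of coarse blocks, then the inner sums
`u′ ↦ |w₂ u′|·m u u′` are summable, `u ↦ |w₁ u|·Σ'_{u′} |w₂ u′|·m u u′` is summable, and
`Σ'_u |w₁ u|·Σ'_{u′} |w₂ u′|·m u u′ ≤ W₁·W₂·e^{ρ·D·n}·e^{ρ·D·n}·T·Zl D (ρ·n∕2)·Zl D (θ∕2)·e^{−min (ρ·n∕2) (θ∕2)·|y′ − y|₁}` — regroup BOTH absolutely convergent sums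
by coarse blocks (`KKTFluctuationEnergy.tsum_blocks`), pay the two in-block offsets (`exp_block_offset_le`), bound each block pair by its total, and sum the
coarse double convolution with d1-leaf-04's `RestNestedMass.tsum_tsum_exp_triangle_le` at `a = ρ·n`.  Only the block-PAIR totals of `m` are seen. -/
theorem tsum_mul_tsum_le_of_blockPairTotal {D n : ℕ} [NeZero n] {w₁ w₂ : (Fin D → ℤ) → ℝ} {m : (Fin D → ℤ) → (Fin D → ℤ) → ℝ}
    {W₁ W₂ ρ θ T : ℝ} (y y' : Fin D → ℤ) (hρ : 0 < ρ) (hθ : 0 < θ) (hW₁ : 0 ≤ W₁) (hW₂ : 0 ≤ W₂)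
    (hw₁ : ∀ u, |w₁ u| ≤ W₁ * Real.exp (-ρ * l1 (u - (n : ℤ) • y)))
    (hw₂ : ∀ u', |w₂ u'| ≤ W₂ * Real.exp (-ρ * l1 (u' - (n : ℤ) • y')))
    (hm0 : ∀ u u', 0 ≤ m u u')
    (hmB : ∀ y₁ y₂ : Fin D → ℤ, ∑ b ∈ box D n, ∑ b' ∈ box D n, m ((n : ℤ) • y₁ + toSite b) ((n : ℤ) • y₂ + toSite b')
      ≤ T * Real.exp (-θ * l1 (y₂ - y₁))) :
    (∀ u, Summable fun u' : Fin D → ℤ => |w₂ u'| * m u u') ∧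
      (Summable fun u : Fin D → ℤ => |w₁ u| * ∑' u' : Fin D → ℤ, |w₂ u'| * m u u') ∧
      ∑' u : Fin D → ℤ, |w₁ u| * ∑' u' : Fin D → ℤ, |w₂ u'| * m u u'
        ≤ W₁ * W₂ * (Real.exp (ρ * (D : ℝ) * (n : ℝ)) * Real.exp (ρ * (D : ℝ) * (n : ℝ))) * T
          * (Zl D (ρ * (n : ℝ) / 2) * Zl D (θ / 2)) * Real.exp (-(min (ρ * (n : ℝ) / 2) (θ / 2)) * l1 (y' - y)) := by
  have hn1 : 1 ≤ n := Nat.one_le_iff_ne_zero.mpr (NeZero.ne n)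
  have hn0 : (0 : ℝ) < (n : ℝ) := by exact_mod_cast Nat.pos_of_ne_zero (NeZero.ne n)
  set c₁ : Fin D → ℤ := (n : ℤ) • y with hc₁
  set c₂ : Fin D → ℤ := (n : ℤ) • y' with hc₂
  set a : ℝ := ρ * (n : ℝ) with ha
  have ha0 : 0 < a := mul_pos hρ hn0
  set E : ℝ := Real.exp (ρ * (D : ℝ) * (n : ℝ)) with hE
  -- a single slot pair is one term of its block-pair total, and the coarse exponential is at most one
  have hmT : ∀ u u', m u u' ≤ T := by
    intro u u'
    have hu : (n : ℤ) • AveragingContours.blk n u + toSite (off n u) = u := blk_add_off hn1 u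
    have hu' : (n : ℤ) • AveragingContours.blk n u' + toSite (off n u') = u' := blk_add_off hn1 u'
    have h1 : m ((n : ℤ) • AveragingContours.blk n u + toSite (off n u)) ((n : ℤ) • AveragingContours.blk n u' + toSite (off n u'))
        ≤ ∑ b' ∈ box D n, m ((n : ℤ) • AveragingContours.blk n u + toSite (off n u)) ((n : ℤ) • AveragingContours.blk n u' + toSite b') :=
      Finset.single_le_sum (f := fun b' => m ((n : ℤ) • AveragingContours.blk n u + toSite (off n u))
        ((n : ℤ) • AveragingContours.blk n u' + toSite b')) (fun _ _ => hm0 _ _) (off_mem_box hn1 u')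
    have h2 : ∑ b' ∈ box D n, m ((n : ℤ) • AveragingContours.blk n u + toSite (off n u)) ((n : ℤ) • AveragingContours.blk n u' + toSite b')
        ≤ ∑ b ∈ box D n, ∑ b' ∈ box D n, m ((n : ℤ) • AveragingContours.blk n u + toSite b) ((n : ℤ) • AveragingContours.blk n u' + toSite b') :=
      Finset.single_le_sum (f := fun b => ∑ b' ∈ box D n, m ((n : ℤ) • AveragingContours.blk n u + toSite b)
        ((n : ℤ) • AveragingContours.blk n u' + toSite b')) (fun _ _ => Finset.sum_nonneg fun _ _ => hm0 _ _) (off_mem_box hn1 u)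
    have h3 := hmB (AveragingContours.blk n u) (AveragingContours.blk n u')
    have h4 : T * Real.exp (-θ * l1 (AveragingContours.blk n u' - AveragingContours.blk n u)) ≤ T * 1 := by
      have hT : 0 ≤ T := by
        have h0 := (Finset.sum_nonneg fun b _ => Finset.sum_nonneg fun b' _ => hm0 _ _).trans h3
        exact (mul_nonneg_iff_of_pos_right (Real.exp_pos _)).1 h0
      exact mul_le_mul_of_nonneg_left (Real.exp_le_one_iff.2 (by nlinarith [hθ.le, l1_nonneg (AveragingContours.blk n u' - AveragingContours.blk n u)])) hT
    rw [hu, hu'] at h1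
    rw [hu] at h2
    linarith
  have hT : 0 ≤ T := (hm0 0 0).trans (hmT 0 0)
  -- (i) inner summability, and a crude inner bound
  have hin_maj : ∀ u u', |w₂ u'| * m u u' ≤ W₂ * T * Real.exp (-ρ * l1 (u' - c₂)) := fun u u' => by
    calc |w₂ u'| * m u u' ≤ (W₂ * Real.exp (-ρ * l1 (u' - c₂))) * T := mul_le_mul (hw₂ u') (hmT u u') (hm0 u u') (by positivity)
      _ = W₂ * T * Real.exp (-ρ * l1 (u' - c₂)) := by ring
  have hin : ∀ u, Summable fun u' : Fin D → ℤ => |w₂ u'| * m u u' := fun u =>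
    Summable.of_nonneg_of_le (fun u' => mul_nonneg (abs_nonneg _) (hm0 u u')) (hin_maj u)
      ((summable_exp_shift' hρ c₂).mul_left (W₂ * T))
  have hin_le : ∀ u, ∑' u' : Fin D → ℤ, |w₂ u'| * m u u' ≤ W₂ * T * Zl D ρ := fun u => by
    refine ((hin u).tsum_le_tsum (hin_maj u) ((summable_exp_shift' hρ c₂).mul_left (W₂ * T))).trans (le_of_eq ?_)
    rw [tsum_mul_left, tsum_exp_shift']
  have hin0 : ∀ u, 0 ≤ ∑' u' : Fin D → ℤ, |w₂ u'| * m u u' := fun u => tsum_nonneg fun u' => mul_nonneg (abs_nonneg _) (hm0 u u')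
  -- (ii) outer summability
  have hout_maj : ∀ u, |w₁ u| * ∑' u' : Fin D → ℤ, |w₂ u'| * m u u' ≤ W₁ * (W₂ * T * Zl D ρ) * Real.exp (-ρ * l1 (u - c₁)) := fun u => by
    calc |w₁ u| * ∑' u' : Fin D → ℤ, |w₂ u'| * m u u' ≤ (W₁ * Real.exp (-ρ * l1 (u - c₁))) * (W₂ * T * Zl D ρ) :=
          mul_le_mul (hw₁ u) (hin_le u) (hin0 u) (by positivity)
      _ = W₁ * (W₂ * T * Zl D ρ) * Real.exp (-ρ * l1 (u - c₁)) := by ring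
  have hout : Summable fun u : Fin D → ℤ => |w₁ u| * ∑' u' : Fin D → ℤ, |w₂ u'| * m u u' :=
    Summable.of_nonneg_of_le (fun u => mul_nonneg (abs_nonneg _) (hin0 u)) hout_maj
      ((summable_exp_shift' hρ c₁).mul_left (W₁ * (W₂ * T * Zl D ρ)))
  refine ⟨hin, hout, ?_⟩
  -- (iii) the bound: the coarse double convolution of d1-leaf-04
  obtain ⟨hcin, hcout, hcsum⟩ := tsum_tsum_exp_triangle_le (D := D) ha0 hθ y y'
  -- the block-pair bound: for every pair of coarse blocks
  have hpair : ∀ y₁ y₂ : Fin D → ℤ, ∑ b ∈ box D n, |w₁ ((n : ℤ) • y₁ + toSite b)|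
        * ∑ b' ∈ box D n, |w₂ ((n : ℤ) • y₂ + toSite b')| * m ((n : ℤ) • y₁ + toSite b) ((n : ℤ) • y₂ + toSite b')
      ≤ W₁ * W₂ * (E * E) * T
        * (Real.exp (-a * l1 (y₁ - y)) * Real.exp (-a * l1 (y₂ - y')) * Real.exp (-θ * l1 (y₂ - y₁))) := by
    intro y₁ y₂
    have hb1 : ∀ b ∈ box D n, |w₁ ((n : ℤ) • y₁ + toSite b)| ≤ W₁ * E * Real.exp (-a * l1 (y₁ - y)) := fun b hb => by
      calc |w₁ ((n : ℤ) • y₁ + toSite b)| ≤ W₁ * Real.exp (-ρ * l1 ((n : ℤ) • y₁ + toSite b - (n : ℤ) • y)) := by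
            have h := hw₁ ((n : ℤ) • y₁ + toSite b); rwa [hc₁] at h
        _ ≤ W₁ * (E * Real.exp (-(ρ * (n : ℝ)) * l1 (y₁ - y))) := mul_le_mul_of_nonneg_left (exp_block_offset_le hρ.le y y₁ hb) hW₁
        _ = W₁ * E * Real.exp (-a * l1 (y₁ - y)) := by rw [ha]; ring
    have hb2 : ∀ b' ∈ box D n, |w₂ ((n : ℤ) • y₂ + toSite b')| ≤ W₂ * E * Real.exp (-a * l1 (y₂ - y')) := fun b' hb' => by
      calc |w₂ ((n : ℤ) • y₂ + toSite b')| ≤ W₂ * Real.exp (-ρ * l1 ((n : ℤ) • y₂ + toSite b' - (n : ℤ) • y')) := by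
            have h := hw₂ ((n : ℤ) • y₂ + toSite b'); rwa [hc₂] at h
        _ ≤ W₂ * (E * Real.exp (-(ρ * (n : ℝ)) * l1 (y₂ - y'))) := mul_le_mul_of_nonneg_left (exp_block_offset_le hρ.le y' y₂ hb') hW₂
        _ = W₂ * E * Real.exp (-a * l1 (y₂ - y')) := by rw [ha]; ring
    calc ∑ b ∈ box D n, |w₁ ((n : ℤ) • y₁ + toSite b)|
          * ∑ b' ∈ box D n, |w₂ ((n : ℤ) • y₂ + toSite b')| * m ((n : ℤ) • y₁ + toSite b) ((n : ℤ) • y₂ + toSite b')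
        ≤ ∑ b ∈ box D n, (W₁ * E * Real.exp (-a * l1 (y₁ - y)))
          * ∑ b' ∈ box D n, (W₂ * E * Real.exp (-a * l1 (y₂ - y'))) * m ((n : ℤ) • y₁ + toSite b) ((n : ℤ) • y₂ + toSite b') := by
          refine Finset.sum_le_sum fun b hb => ?_
          refine mul_le_mul (hb1 b hb) (Finset.sum_le_sum fun b' hb' => mul_le_mul_of_nonneg_right (hb2 b' hb') (hm0 _ _)) ?_ (by positivity)
          exact Finset.sum_nonneg fun b' _ => mul_nonneg (abs_nonneg _) (hm0 _ _)
      _ = (W₁ * E * Real.exp (-a * l1 (y₁ - y))) * (W₂ * E * Real.exp (-a * l1 (y₂ - y')))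
          * ∑ b ∈ box D n, ∑ b' ∈ box D n, m ((n : ℤ) • y₁ + toSite b) ((n : ℤ) • y₂ + toSite b') := by
          simp only [Finset.mul_sum]
          refine Finset.sum_congr rfl fun b _ => Finset.sum_congr rfl fun b' _ => ?_
          ring
      _ ≤ (W₁ * E * Real.exp (-a * l1 (y₁ - y))) * (W₂ * E * Real.exp (-a * l1 (y₂ - y'))) * (T * Real.exp (-θ * l1 (y₂ - y₁))) :=
          mul_le_mul_of_nonneg_left (hmB y₁ y₂) (by positivity)
      _ = W₁ * W₂ * (E * E) * T * (Real.exp (-a * l1 (y₁ - y)) * Real.exp (-a * l1 (y₂ - y')) * Real.exp (-θ * l1 (y₂ - y₁))) := by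
          ring
  set K : ℝ := W₁ * W₂ * (E * E) * T with hK
  have hK0 : 0 ≤ K := by positivity
  -- regroup the outer sum by blocks
  have hGb := tsum_blocks (N := n) hout
  rw [hGb]
  -- per outer block: regroup the inner sums by blocks and bound by the coarse family
  have hblk : ∀ y₁ : Fin D → ℤ, ∑ b ∈ box D n, |w₁ ((n : ℤ) • y₁ + toSite b)| * ∑' u' : Fin D → ℤ, |w₂ u'| * m ((n : ℤ) • y₁ + toSite b) u'
      ≤ K * ∑' y₂ : Fin D → ℤ, Real.exp (-a * l1 (y₁ - y)) * Real.exp (-a * l1 (y₂ - y')) * Real.exp (-θ * l1 (y₂ - y₁)) := by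
    intro y₁
    -- inner regrouping, block by block
    have e1 : ∑ b ∈ box D n, |w₁ ((n : ℤ) • y₁ + toSite b)| * ∑' u' : Fin D → ℤ, |w₂ u'| * m ((n : ℤ) • y₁ + toSite b) u'
        = ∑ b ∈ box D n, ∑' y₂ : Fin D → ℤ, |w₁ ((n : ℤ) • y₁ + toSite b)|
            * ∑ b' ∈ box D n, |w₂ ((n : ℤ) • y₂ + toSite b')| * m ((n : ℤ) • y₁ + toSite b) ((n : ℤ) • y₂ + toSite b') := by
      refine Finset.sum_congr rfl fun b _ => ?_
      rw [tsum_blocks (N := n) (hin ((n : ℤ) • y₁ + toSite b)), ← tsum_mul_left]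
    have hsb : ∀ b ∈ box D n, Summable fun y₂ : Fin D → ℤ => |w₁ ((n : ℤ) • y₁ + toSite b)|
        * ∑ b' ∈ box D n, |w₂ ((n : ℤ) • y₂ + toSite b')| * m ((n : ℤ) • y₁ + toSite b) ((n : ℤ) • y₂ + toSite b') :=
      fun b _ => (summable_blocks (N := n) (hin ((n : ℤ) • y₁ + toSite b))).mul_left _
    rw [e1, ← Summable.tsum_finsetSum hsb]
    have hmaj := (hcin y₁).mul_left K
    refine (Summable.tsum_le_tsum (fun y₂ => ?_) (summable_sum hsb) hmaj).trans (le_of_eq tsum_mul_left)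
    exact hpair y₁ y₂
  have hmajO := hcout.mul_left K
  -- (the coarse block family's summability is taken from the lemma UNANNOTATED: an expected type here makes the elaborator face a
  -- non-pattern higher-order unification and time out)
  have hsbO := summable_blocks (N := n) hout
  have hstep1 := Summable.tsum_le_tsum hblk hsbO hmajO
  refine hstep1.trans ?_
  rw [tsum_mul_left]
  refine (mul_le_mul_of_nonneg_left hcsum hK0).trans (le_of_eq ?_)
  rw [hK, hE, ha]
  ring

end Generic

/-! ## §2 Generic kernel form: the plain mass of a nested superposition from block-pair totals -/

section Nested

variable {D n : ℕ} [NeZero n] {F : Type*} [Fintype F] {ι : Type*} [Fintype ι]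

/-- [folklore] **MASS OF A NESTED SUPERPOSITION FROM BLOCK-PAIR TOTALS** (the block-pair-total companion of d1-leaf-04's `RestNestedMass.mass_nested_wsum_le`):
weight families `w₁ w₂ : ι → Site D → ℝ` with envelopes `|w₁ i u| ≤ C₁·e^{−ρ|u − n•y|₁}`, `|w₂ i u′| ≤ C₂·e^{−ρ|u′ − n•y′|₁}` (`0 < ρ`, `0 ≤ C₁, C₂`) and pair stencils
`P i u i′ u′` with summable PLAIN masses whose BLOCK-PAIR totals satisfy `Σ_{b,b′ ∈ box D n} mass (P i (n•y₁+b) i′ (n•y₂+b′)) ≤ T·e^{−θ|y₂ − y₁|₁}` (`0 < θ`; every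
colour pair, every pair of coarse blocks) make the nested superposition `Σ_i wsum (w₁ i) (u ↦ Σ_{i′} wsum (w₂ i′) (P i u i′))` a kernel with summable plain mass
`≤ |ι|·|ι|·(C₁·C₂·e^{ρDn}·e^{ρDn}·T·Zl D (ρn∕2)·Zl D (θ∕2)·e^{−min (ρn∕2) (θ∕2)|y′ − y|₁})` — inner and outer `mass_wsum_le` with the ACTUAL masses as letters, then §1
colour pair by colour pair. -/
theorem mass_nested_wsum_le_of_blockPairTotal {w₁ w₂ : ι → (Fin D → ℤ) → ℝ} {P : ι → (Fin D → ℤ) → ι → (Fin D → ℤ) → MKer D F}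
    {C₁ C₂ ρ θ T : ℝ} (y y' : Fin D → ℤ) (hρ : 0 < ρ) (hθ : 0 < θ) (hC₁ : 0 ≤ C₁) (hC₂ : 0 ≤ C₂)
    (hw₁ : ∀ i u, |w₁ i u| ≤ C₁ * Real.exp (-ρ * l1 (u - (n : ℤ) • y)))
    (hw₂ : ∀ i u', |w₂ i u'| ≤ C₂ * Real.exp (-ρ * l1 (u' - (n : ℤ) • y')))
    (hPs : ∀ i u i' u', Summable fun p : Site D × Site D => ∑ g, ∑ f, |P i u i' u' p.1 p.2 g f|)
    (hPB : ∀ (i i' : ι) (y₁ y₂ : Fin D → ℤ), ∑ b ∈ box D n, ∑ b' ∈ box D n,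
      (∑' p : Site D × Site D, ∑ g, ∑ f, |P i ((n : ℤ) • y₁ + toSite b) i' ((n : ℤ) • y₂ + toSite b') p.1 p.2 g f|)
        ≤ T * Real.exp (-θ * l1 (y₂ - y₁))) :
    (Summable fun p : Site D × Site D =>
        ∑ g, ∑ f, |(∑ i, wsum (w₁ i) (fun u => ∑ i', wsum (w₂ i') (P i u i'))) p.1 p.2 g f|) ∧
      ∑' p : Site D × Site D, ∑ g, ∑ f, |(∑ i, wsum (w₁ i) (fun u => ∑ i', wsum (w₂ i') (P i u i'))) p.1 p.2 g f|
        ≤ (Fintype.card ι : ℝ) * (Fintype.card ι : ℝ)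
          * (C₁ * C₂ * (Real.exp (ρ * (D : ℝ) * (n : ℝ)) * Real.exp (ρ * (D : ℝ) * (n : ℝ))) * T
            * (Zl D (ρ * (n : ℝ) / 2) * Zl D (θ / 2)) * Real.exp (-(min (ρ * (n : ℝ) / 2) (θ / 2)) * l1 (y' - y))) := by
  set B : ℝ := C₁ * C₂ * (Real.exp (ρ * (D : ℝ) * (n : ℝ)) * Real.exp (ρ * (D : ℝ) * (n : ℝ))) * T
    * (Zl D (ρ * (n : ℝ) / 2) * Zl D (θ / 2)) * Real.exp (-(min (ρ * (n : ℝ) / 2) (θ / 2)) * l1 (y' - y)) with hB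
  -- the ACTUAL plain masses of the pair stencils, as the per-slot-pair letters
  set M : ι → (Fin D → ℤ) → ι → (Fin D → ℤ) → ℝ := fun i u i' u' =>
    ∑' p : Site D × Site D, ∑ g, ∑ f, |P i u i' u' p.1 p.2 g f| with hM
  have hM0 : ∀ i u i' u', 0 ≤ M i u i' u' := fun i u i' u' =>
    tsum_nonneg fun p => Finset.sum_nonneg fun g _ => Finset.sum_nonneg fun f _ => abs_nonneg _
  -- §1, colour pair by colour pair
  have hgen : ∀ i i', (∀ u, Summable fun u' : Fin D → ℤ => |w₂ i' u'| * M i u i' u') ∧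
      (Summable fun u : Fin D → ℤ => |w₁ i u| * ∑' u' : Fin D → ℤ, |w₂ i' u'| * M i u i' u') ∧
      ∑' u : Fin D → ℤ, |w₁ i u| * ∑' u' : Fin D → ℤ, |w₂ i' u'| * M i u i' u' ≤ B := fun i i' =>
    tsum_mul_tsum_le_of_blockPairTotal (m := fun u u' => M i u i' u') y y' hρ hθ hC₁ hC₂ (hw₁ i) (hw₂ i')
      (fun u u' => hM0 i u i' u') (fun y₁ y₂ => hPB i i' y₁ y₂)
  have hWpos : ∀ _p : Site D × Site D, (0 : ℝ) < 1 := fun _ => one_pos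
  -- STEP A: the inner kernels `u ↦ Σ_{i′} wsum (w₂ i′) (P i u i′)` have plain mass `≤ Σ_{i′} Σ'_{u′} |w₂ i′ u′|·M i u i′ u′`
  have hin : ∀ i u i', (Summable fun p : Site D × Site D => ∑ g, ∑ f, |wsum (w₂ i') (P i u i') p.1 p.2 g f| * (1 : ℝ)) ∧
      ∑' p : Site D × Site D, ∑ g, ∑ f, |wsum (w₂ i') (P i u i') p.1 p.2 g f| * (1 : ℝ)
        ≤ ∑' u' : Fin D → ℤ, |w₂ i' u'| * M i u i' u' := fun i u i' =>
    mass_wsum_le (W := fun _ => (1 : ℝ)) (ρ := fun u' => M i u i' u') hWpos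
      (fun u' => by simpa only [mul_one] using hPs i u i' u') (fun u' => by simp only [mul_one]; exact le_rfl) ((hgen i i').1 u)
  have hA : ∀ i u, (Summable fun p : Site D × Site D => ∑ g, ∑ f, |(∑ i', wsum (w₂ i') (P i u i')) p.1 p.2 g f| * (1 : ℝ)) ∧
      ∑' p : Site D × Site D, ∑ g, ∑ f, |(∑ i', wsum (w₂ i') (P i u i')) p.1 p.2 g f| * (1 : ℝ)
        ≤ ∑ i', ∑' u' : Fin D → ℤ, |w₂ i' u'| * M i u i' u' := fun i u =>
    mass_finset_sum_le (Finset.univ : Finset ι) (fun p => (hWpos p).le) (fun i' _ => (hin i u i').1) (fun i' _ => (hin i u i').2)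
  -- STEP B: the outer superposition, colour by colour
  have hws : ∀ i, Summable fun u : Fin D → ℤ => |w₁ i u| * ∑ i', ∑' u' : Fin D → ℤ, |w₂ i' u'| * M i u i' u' := fun i => by
    have e : (fun u : Fin D → ℤ => |w₁ i u| * ∑ i', ∑' u' : Fin D → ℤ, |w₂ i' u'| * M i u i' u')
        = fun u => ∑ i', |w₁ i u| * ∑' u' : Fin D → ℤ, |w₂ i' u'| * M i u i' u' := funext fun u => Finset.mul_sum _ _ _
    rw [e]
    exact summable_sum fun i' _ => (hgen i i').2.1
  have hout : ∀ i, (Summable fun p : Site D × Site D => ∑ g, ∑ f,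
        |wsum (w₁ i) (fun u => ∑ i', wsum (w₂ i') (P i u i')) p.1 p.2 g f| * (1 : ℝ)) ∧
      ∑' p : Site D × Site D, ∑ g, ∑ f, |wsum (w₁ i) (fun u => ∑ i', wsum (w₂ i') (P i u i')) p.1 p.2 g f| * (1 : ℝ)
        ≤ ∑' u : Fin D → ℤ, |w₁ i u| * ∑ i', ∑' u' : Fin D → ℤ, |w₂ i' u'| * M i u i' u' := fun i =>
    mass_wsum_le (W := fun _ => (1 : ℝ)) (K := fun u => ∑ i', wsum (w₂ i') (P i u i'))
      (ρ := fun u => ∑ i', ∑' u' : Fin D → ℤ, |w₂ i' u'| * M i u i' u') hWpos (fun u => (hA i u).1) (fun u => (hA i u).2) (hws i)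
  -- the outer letter: `Σ'_u |w₁ i u|·Σ_{i′} (…) = Σ_{i′} Σ'_u |w₁ i u|·(…) ≤ |ι|·B`
  have hle : ∀ i, ∑' u : Fin D → ℤ, |w₁ i u| * ∑ i', ∑' u' : Fin D → ℤ, |w₂ i' u'| * M i u i' u' ≤ (Fintype.card ι : ℝ) * B := by
    intro i
    have e : (fun u : Fin D → ℤ => |w₁ i u| * ∑ i', ∑' u' : Fin D → ℤ, |w₂ i' u'| * M i u i' u')
        = fun u => ∑ i', |w₁ i u| * ∑' u' : Fin D → ℤ, |w₂ i' u'| * M i u i' u' := funext fun u => Finset.mul_sum _ _ _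
    rw [e, Summable.tsum_finsetSum (fun i' _ => (hgen i i').2.1)]
    calc ∑ i', ∑' u : Fin D → ℤ, |w₁ i u| * ∑' u' : Fin D → ℤ, |w₂ i' u'| * M i u i' u'
        ≤ ∑ _i' : ι, B := Finset.sum_le_sum fun i' _ => (hgen i i').2.2
      _ = (Fintype.card ι : ℝ) * B := by rw [Finset.sum_const, Finset.card_univ, nsmul_eq_mul]
  have h := mass_finset_sum_le (Finset.univ : Finset ι) (fun p => (hWpos p).le) (fun i _ => (hout i).1)
    (fun i _ => (hout i).2.trans (hle i))
  simp only [mul_one] at h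
  refine ⟨h.1, h.2.trans (le_of_eq ?_)⟩
  rw [Finset.sum_const, Finset.card_univ, nsmul_eq_mul]
  ring

end Nested

/-! ## §3 `d = 3`: the block masses of a packed second-order table from block-pair totals, any packed `K` with a column envelope -/

section Packed

/-- [folklore] **THE BLOCK MASSES OF A PACKED SECOND-ORDER TABLE FROM BLOCK-PAIR TOTALS** (any packed `K`; the block-pair-total companion of
`RestTableBlockMass.mass_blk_vertex2OfK_le`): a column envelope `|colH K n ρ′ y κ u| ≤ C_H·e^{−ρ|u − n•y|₁}` (`0 < ρ`, `0 ≤ C_H`), per-slot-pair summable plain block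
masses of the pair pack `S₂` and BLOCK-PAIR totals `Σ_{b,b′ ∈ box 4 n} Σ'|blk (S₂ κ (n•y₁+b) κ′ (n•y₂+b′)) j i| ≤ T j i·e^{−θ|y₂ − y₁|₁}` (`0 < θ`) give, for every
pair of coarse bonds and every block, a summable plain mass of `blk (vertex2OfK K n S₂ μ y ν y′) j i` bounded by
`16·C_H·C_H·e^{ρ·4·n}·e^{ρ·4·n}·T j i·Zl 4 (ρn∕2)·Zl 4 (θ∕2)·e^{−min (ρn∕2) (θ∕2)·|y′ − y|₁}`. -/
theorem mass_blk_vertex2OfK_le_of_blockPairTotal (K : MKer 4 (Fib 3)) (n : ℕ) [NeZero n]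
    {S₂ : Fin 4 → Site 4 → Fin 4 → Site 4 → MKer 4 (Fib 3)} {CH ρ θ : ℝ} {T : Bool → Bool → ℝ}
    (hρ : 0 < ρ) (hθ : 0 < θ) (hCH : 0 ≤ CH)
    (hcol : ∀ ρ' y κ u, |colH K n ρ' y κ u| ≤ CH * Real.exp (-ρ * l1 (u - (n : ℤ) • y)))
    (hTs : ∀ κ u κ' u' j i, Summable fun p : Site 4 × Site 4 => ∑ g, ∑ f, |blk (S₂ κ u κ' u') j i p.1 p.2 g f|)
    (hTB : ∀ (κ κ' : Fin 4) (y₁ y₂ : Site 4) (j i : Bool), ∑ b ∈ box 4 n, ∑ b' ∈ box 4 n,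
      (∑' p : Site 4 × Site 4, ∑ g, ∑ f, |blk (S₂ κ ((n : ℤ) • y₁ + toSite b) κ' ((n : ℤ) • y₂ + toSite b')) j i p.1 p.2 g f|)
        ≤ T j i * Real.exp (-θ * l1 (y₂ - y₁)))
    (μ : Fin 4) (y : Site 4) (ν : Fin 4) (y' : Site 4) (j i : Bool) :
    (Summable fun p : Site 4 × Site 4 => ∑ g, ∑ f, |blk (vertex2OfK K n S₂ μ y ν y') j i p.1 p.2 g f|) ∧
      ∑' p : Site 4 × Site 4, ∑ g, ∑ f, |blk (vertex2OfK K n S₂ μ y ν y') j i p.1 p.2 g f|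
        ≤ 16 * (CH * CH * (Real.exp (ρ * (4 : ℝ) * (n : ℝ)) * Real.exp (ρ * (4 : ℝ) * (n : ℝ))) * T j i
            * (Zl 4 (ρ * (n : ℝ) / 2) * Zl 4 (θ / 2)) * Real.exp (-(min (ρ * (n : ℝ) / 2) (θ / 2)) * l1 (y' - y))) := by
  rw [blk_vertex2OfK]
  have h := mass_nested_wsum_le_of_blockPairTotal (D := 4) (n := n) (ι := Fin 4) (w₁ := fun κ => colH K n μ y κ) (w₂ := fun κ => colH K n ν y' κ)
    (P := fun κ u κ' u' => blk (S₂ κ u κ' u') j i) (T := T j i) y y' hρ hθ hCH hCH (fun κ u => hcol μ y κ u) (fun κ u => hcol ν y' κ u)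
    (fun κ u κ' u' => hTs κ u κ' u' j i) (fun κ κ' y₁ y₂ => hTB κ κ' y₁ y₂ j i)
  refine ⟨h.1, h.2.trans (le_of_eq ?_)⟩
  rw [Fintype.card_fin]
  push_cast
  ring

end Packed

/-! ## §4 The road's gauged packed weights `colH (G₀^{bm} r) n`, any in-block root -/

section Road

variable (m : ℕ) {r : Fin (3 + 1) → ℕ} (hr : r ∈ box (3 + 1) (m + 1))
include hr

/-- [folklore] **«G0-TABLE-MASS» FROM BLOCK-PAIR TOTALS — THE (M-b) SHAPE FOR A COVARIANCE-TYPE PAIR SECTOR** (UNCONDITIONAL; any in-block root `r`, the hybrid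
pin's `ctrOff 4 n` included): for a pair pack `S₂` with per-slot-pair summable plain block masses and BLOCK-PAIR totals
`Σ_{b,b′ ∈ box 4 n} Σ'|blk (S₂ κ (n•y₁+b) κ′ (n•y₂+b′)) j i| ≤ n⁸·m̄B j i·e^{−θ|y₂ − y₁|₁}` (`0 < θ`, BLOCK units; `m̄B` = the slot-pair-AVERAGED block mass), every
block of `vertex2OfK (G₀^{bm} r) n S₂ μ y ν y′` has summable plain mass
`≤ 16·C_{G₀}²·e^{2κ′}·Zl 4 (κ′∕8)·Zl 4 (θ∕2)·m̄B j i·e^{−min (κ′∕8) (θ∕2)·|y′ − y|₁}` — §3 at «G0-COL-ENV» (`C_H = (n⁴)⁻¹·C_{G₀}`, `ρ = κ′∕(4n)`: offsets `e^{κ′}` twice,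
`ρn∕2 = κ′∕8`, `(n⁴)⁻²·n⁸ = 1`) — POWER `n⁰`, k-free on the scales whenever `m̄B`, `θ` are; the block-pair-total companion of
`PackedColumnTableMass.mass_blk_vertex2OfK_G₀_le_blockRate` (per slot pair: `16·C_{G₀}²·(1 + 16∕κ′)⁴·Zl 4 (δ₀∕(2n))·(n⁴)⁻¹·mT j i·e^{−min (κ′∕8) (δ₀∕2)|y′ − y|₁}`). -/
theorem mass_blk_vertex2OfK_G₀_le_of_blockPairTotal {S₂ : Fin 4 → Site 4 → Fin 4 → Site 4 → MKer 4 (Fib 3)} {θ : ℝ} {mB : Bool → Bool → ℝ}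
    (hθ : 0 < θ)
    (hTs : ∀ κ u κ' u' j i, Summable fun p : Site 4 × Site 4 => ∑ g, ∑ f, |blk (S₂ κ u κ' u') j i p.1 p.2 g f|)
    (hTB : ∀ (κ κ' : Fin 4) (y₁ y₂ : Site 4) (j i : Bool), ∑ b ∈ box 4 (m + 1), ∑ b' ∈ box 4 (m + 1),
      (∑' p : Site 4 × Site 4, ∑ g, ∑ f,
        |blk (S₂ κ (((m + 1 : ℕ) : ℤ) • y₁ + toSite b) κ' (((m + 1 : ℕ) : ℤ) • y₂ + toSite b')) j i p.1 p.2 g f|)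
        ≤ ((m + 1 : ℕ) : ℝ) ^ 8 * mB j i * Real.exp (-θ * l1 (y₂ - y₁)))
    (μ : Fin 4) (y : Site 4) (ν : Fin 4) (y' : Site 4) (j i : Bool) :
    (Summable fun p : Site 4 × Site 4 => ∑ g, ∑ f,
        |blk (vertex2OfK (coDressKBmAt (toSite r) (m + 1) (KInvStep (d := 3) (m + 1) 0)) (m + 1) S₂ μ y ν y') j i p.1 p.2 g f|) ∧
      ∑' p : Site 4 × Site 4, ∑ g, ∑ f,
          |blk (vertex2OfK (coDressKBmAt (toSite r) (m + 1) (KInvStep (d := 3) (m + 1) 0)) (m + 1) S₂ μ y ν y') j i p.1 p.2 g f|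
        ≤ 16 * ((MG163 4 * periodConst (kappa163 4) 3) * (1 + 8 * (1 + Real.exp (kappa163 4 / 4))) * Real.exp (kappa163 4 / 4)) ^ 2
            * (Real.exp (kappa163 4 / 4) * Real.exp (kappa163 4 / 4)) * (Zl 4 (kappa163 4 / 4 / 8) * Zl 4 (θ / 2))
          * mB j i * Real.exp (-(min (kappa163 4 / 4 / 8) (θ / 2)) * l1 (y' - y)) := by
  have hn0 : (0 : ℝ) < ((m + 1 : ℕ) : ℝ) := by exact_mod_cast Nat.succ_pos m
  have hκ : 0 < kappa163 4 := kappa163_pos 4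
  set K₀ : ℝ := (MG163 4 * periodConst (kappa163 4) 3) * (1 + 8 * (1 + Real.exp (kappa163 4 / 4))) * Real.exp (kappa163 4 / 4) with hK₀
  set CH : ℝ := (((m + 1 : ℕ) : ℝ) ^ 4)⁻¹ * K₀ with hCH
  set aa : ℝ := kappa163 4 / 4 / (4 * ((m + 1 : ℕ) : ℝ)) with haa
  have haa0 : 0 < aa := by positivity
  -- the column envelope of the road's gauged pack («G0-COL-ENV»)
  have hcol : ∀ ρ' y₀ κ u, |colH (coDressKBmAt (toSite r) (m + 1) (KInvStep (d := 3) (m + 1) 0)) (m + 1) ρ' y₀ κ u|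
      ≤ CH * Real.exp (-aa * l1 (u - ((m + 1 : ℕ) : ℤ) • y₀)) := fun ρ' y₀ κ u => by
    have h := abs_colH_G₀_road_le m hr ρ' y₀ κ u
    rw [hCH, haa]
    exact h
  have hCH0 : 0 ≤ CH := colH_G₀_road_weight_nonneg m
  obtain ⟨hs, hb⟩ := mass_blk_vertex2OfK_le_of_blockPairTotal (coDressKBmAt (toSite r) (m + 1) (KInvStep (d := 3) (m + 1) 0)) (m + 1)
    (T := fun j i => ((m + 1 : ℕ) : ℝ) ^ 8 * mB j i) haa0 hθ hCH0 hcol hTs hTB μ y ν y' j i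
  refine ⟨hs, hb.trans (le_of_eq ?_)⟩
  -- the constants: `aa·4·n = κ′`, `aa·n∕2 = κ′∕8`, `CH·CH·n⁸ = K₀²`
  have e1 : aa * (4 : ℝ) * (((m + 1 : ℕ)) : ℝ) = kappa163 4 / 4 := by rw [haa]; field_simp
  have e2 : aa * (((m + 1 : ℕ)) : ℝ) / 2 = kappa163 4 / 4 / 8 := by rw [haa]; field_simp; ring
  rw [e1, e2, hCH]
  have hn4 : (((m + 1 : ℕ) : ℝ)) ^ 4 ≠ 0 := by positivity
  field_simp

end Road

end Summit.QuantumFields.BalabanUV.Beta.D1BFx.PackedColumnBlockPairTotalMass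

end
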